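import Literature.MathematicalPhysics.QuantumFieldTheory.Balaban1983to89.B7Prop3GeneralTildRec
import Literature.MathematicalPhysics.QuantumFieldTheory.Balaban1983to89.B7Prop3FlatRecSide
import Literature.MathematicalPhysics.QuantumFieldTheory.Balaban1983to89.B7Prop3GeneralLinearSplit

/-!
# `Balaban1983to89.B7Prop3GeneralLinearSplitRec` — [Balaban1985Averaging] PROPOSITION 3 AT A GENERAL BACKGROUND, THE LINEAR PART, (115) and (124) REGROUPED pp. 34–36 — FOR THE RECORD's
# AVERAGING STRUCTURE ([Balaban1987RG1] (0.3)–(0.4)): (115) EXACTLY for every (0.4) loop `Γ ∪ [x,x′] ∪ (−Γ′) ∪ (−c)`, and (124) regrouped for the record — the linear part «L(Q(V₀)A)_c» = the main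
# term `L·(Q₀A)_c` + print's three `[operator − 1]` brackets + THREE RECORD DEFECTS `D₋, D₀, D₊` (staircase-family vs single-staircase frame; LOCATED-N2 at a general background), every sum explicit

statement-level skeleton of published theorems with citation tags; proofs where landed; nothing here is a claim about the Yang–Mills mass gap

CITATION HEADER (lean-in-tree rule).  Cell `pub-ymgap`, seat `pub-ymgap-dag-n05-e` g35 (N05-REC LEAD PEN); item R1 ([3] layer) — file 4 of the Prop. 3 general-background chain for the record; the file where
ROAD (A′) of director-ym №257 (LOCATED-N2: «keep the premise, prove the N2 estimate on n05-e's lane inside R1») becomes a typed identity at a GENERAL background.  `--kind proof --supports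
stmt-QuantumFields-20541` (K0⁷; count-neutral; no definition).  Sources READ: [3] pp. 34–36 (`paper:balaban1985-cmp98-averaging`: (115) p. 34, (120) p. 35, (124)–(125) p. 36), [Balaban1987RG1]
(0.3)–(0.4) pp. 252–253 (`paper:balaban1987-cmp109-rg-i-small-field`); engine module `B7Prop3GeneralLinearSplit` (its §1 `tsum_revWord`, `conjR_sum` REUSED BY NAME).
THE HONEST DIFFERENCE FROM THE ENGINE (typed, not hidden).  The engine's loop is `Γ_{c₋,x} ∪ [x,x′] ∪ (−Γ_{c₊,x′}) ∪ (−c)` with the SAME tree contour `Γ` that builds the frames (82), so in (124) the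
tree-contour pieces of `Σ_x L^{−d}A_x^{(1)}` CANCEL the frame `−F̂_{V₀}(c₋)` exactly (`sum_Aloop_eq`).  The record's (0.4) loop runs over ALL shortest staircases `Γ^σ_{c₋,x}`, `Γ^{σ′}_{c₊,x′}`
(`i = (x, σ, σ′) : IdxZ d L`, weights `|IdxZ|⁻¹`), while its frames (82) follow the input's single-staircase axial gauge `treeWord (offZ L r)` (TOKEN RULE (T3); forced by (82), see
`LOCATED-N2-MIXED-LINEARISATION.md`).  Hence (124) for the record carries three extra DEFECT sums, each vanishing when `stairWord σ = treeWord`: `D₋ = Σ_i w·(R_{0,c₋}A)(Γ^σ_{c₋,x}) − F̂_{V₀}(c₋)`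
(covariant curl functional at `c₋`), `D₀ = Σ_i w·R(V₀(Γ^σ_{c₋,x}))(R_{0,x}A)([x,x′]) − L·(Q₀A)_c` (rotation defect of the main term; zero at a flat background), `D₊ = Σ_i w·R̄_{0,c}[(R_{0,c₊}A)(Γ_{c₊,x′}) −
(R_{0,c₊}A)(Γ^{σ′}_{c₊,x′})]` (covariant curl functional at `c₊`, rotated).  At `V₀ = 1` the identity reduces to `B7Prop3FlatRec`'s `linQZ + Φ(c₋) − Φ(c₊)`.  Their ESTIMATE is the located N2 item
(road (A′)); this file only states (124) truthfully for the typed record.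
WHAT IS PROVED (sorry-free): §1 `loopWord_eq_append`, `disp_gZ`, `hol_gZ_eq` (`V₀(Γ^σ ∪ [x,x′] ∪ (−Γ^{σ′})) = V₀(Γ^σ)V₀([x,x′])V₀(Γ^{σ′})⁻¹`), `WZ_eq_hol_mul` (`W_i = V₀(Γ^σ∪[x,x′]∪(−Γ^{σ′}))·V₀(c)⁻¹`);
§2 ★`AloopZ_eq` — (115) EXACTLY for the record loop; §3 `conjR_bavgZ` (`R̄_{0,c} = R(e^{X₀})∘R(V₀(c))`), `conjR_gZ` (`R(V₀(Γ^σ∪[x,x′]∪(−Γ^{σ′}))) = R(W_i)∘R(V₀(c))`), `FhatCovZ_eq_sum_IdxZ`,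
`conjR_bavgZ_FhatCovZ`, ★★`linQcovZ_split` — (124) REGROUPED FOR THE RECORD: main term + print's three brackets + `D₋ + D₀ + D₊`, under the small-loop guard `‖W_i(V₀) − 1‖ < 1`;
§4 ★★`defects_eq_covGauge` (`D₋ + D₊ = λ_A(c₋) − R̄_{0,c}λ_A(c₊)`: the curl defects ARE a covariant coarse gauge term, by the `σ ↔ σ′` symmetry of (0.4)), ★`linQcovZ_split_gauge` ((124) for the record, gauge form).
HONEST SCOPE.  Exact identities for OUR typed record objects; no estimate ((126) and the N2 bound are the sequel's); `HThm4Rec` UNDISCHARGED; N05 ∕ N07 NOT discharged; counts unmoved (typed 28∕28 ·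
discharged 7∕28); one finite 𝕋⁴ programme at fixed ε — nothing continuum ∕ ℝ⁴ ∕ OS ∕ mass gap ∕ Clay.  No `def`, no `instance`, no `notation`, no `sorry`.
-/

set_option autoImplicit false

noncomputable section

open scoped BigOperators
open NormedSpace Finset

namespace Literature.MathematicalPhysics.QuantumFieldTheory.Balaban1983to89.B7Prop3GeneralLinearSplitRec

open B7Prop1Explicit hiding Site
open B7Prop1Explicit renaming Site → SiteZ
open MatrixLog B7AvgGaugeCovariance B7Prop3GeneralRotated
open B7Prop3Flat (expCfg)
open B7Prop3GeneralLinearSplit (tsum_revWord conjR_sum)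
open B7Eq92Concrete (tHol)
open B7Eq78Linearization (conjR conjR_apply conjR_add conjR_sub conjR_smul conjR_smul_real conjR_one)
open B12AverageCorridor267 (Dmlog PhiY)
open BlockAveragingZd (offZ IdxZ WZ WZ_def XZ bavgZ bavgZ_apply disp_stairWord)
open B7SectCDGaugeAveragesRec (FcovZ wframeZ tildZ dbavgCovZ)
open B7SectEFLinearisationRec (FhatCovZ Q0covZ QcovZ linQcovZ CcovZ AloopZ DXavgZ QprimeCovZ)
open B7Prop3FlatRecSide (wordRev_eq_revWord replicate_true_eq_seg replicate_false_eq_seg_neg sum_IdxZ_fst sum_IdxZ_perm₁)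
open B7Prop3GeneralTildRec (linQcovZ_eq)
open T4Continuum (loopWord stairWord)

variable {d : ℕ}

variable {𝔸 : Type*} [NormedRing 𝔸] [NormedAlgebra ℂ 𝔸] [NormOneClass 𝔸] [CompleteSpace 𝔸]
variable (L : ℕ)

/-! ## §1 The (0.4) loop as `(Γ^σ ∪ [x,x′] ∪ (−Γ^{σ′})) ∪ (−c)` and its holonomy -/

section Words

omit [NormedAlgebra ℂ 𝔸] [NormOneClass 𝔸] [CompleteSpace 𝔸] in
/-- `R(X)(−Y) = −R(X)Y`. [cite: Balaban1985Averaging, (56) p.27] -/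
private theorem conjR_neg (X : 𝔸ˣ) (Y : 𝔸) : conjR X (-Y) = -conjR X Y := by
  simp [conjR_apply]

/-- NODE 00's loop word of (0.4) re-associated as `(Γ^σ ∪ [x,x′] ∪ (−Γ^{σ′})) ∪ (−c)` in the engine's letters (`seg`, `revWord`). [cite: Balaban1987RG1, (0.4) p.253] -/
theorem loopWord_eq_append (κ : Fin d) (n : SiteZ d) (σ σ' : Equiv.Perm (Fin d)) :
    loopWord L κ n σ σ' = (stairWord σ n ++ seg κ (L : ℤ) ++ revWord (stairWord σ' n)) ++ seg κ (-(L : ℤ)) := by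
  rw [T4Continuum.loopWord, replicate_true_eq_seg, replicate_false_eq_seg_neg, wordRev_eq_revWord]
  simp only [List.append_assoc]

/-- The open three-piece contour `Γ^σ_{c₋,x} ∪ [x,x′] ∪ (−Γ^{σ′}_{c₊,x′})` runs from `c₋` to `c₊`. [cite: Balaban1987RG1, (0.3)–(0.4) pp.252–253] -/
theorem disp_gZ (κ : Fin d) (n : SiteZ d) (σ σ' : Equiv.Perm (Fin d)) :
    disp (stairWord σ n ++ seg κ (L : ℤ) ++ revWord (stairWord σ' n)) = (L : ℤ) • e κ := by
  simp only [disp_append, disp_stairWord, disp_seg, disp_revWord]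
  abel

omit [NormedAlgebra ℂ 𝔸] [NormOneClass 𝔸] [CompleteSpace 𝔸] in
/-- The three-piece holonomy factorised: `V₀(Γ^σ_{c₋,x} ∪ [x,x′] ∪ (−Γ^{σ′}_{c₊,x′})) = V₀(Γ^σ_{c₋,x})·V₀([x,x′])·V₀(Γ^{σ′}_{c₊,x′})⁻¹`.
[cite: Balaban1985Averaging, (14) p.19; Balaban1987RG1, (0.4) p.253] -/
theorem hol_gZ_eq (V₀ : SiteZ d → Fin d → 𝔸ˣ) (q : SiteZ d) (κ : Fin d) (n : SiteZ d) (σ σ' : Equiv.Perm (Fin d)) :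
    hol V₀ q (stairWord σ n ++ seg κ (L : ℤ) ++ revWord (stairWord σ' n))
      = hol V₀ q (stairWord σ n) * hol V₀ (q + n) (seg κ L)
        * (hol V₀ (q + (L : ℤ) • e κ) (stairWord σ' n))⁻¹ := by
  rw [hol_append, hol_append, disp_append, disp_stairWord, disp_seg,
    hol_revWord' V₀ (x := q + (L : ℤ) • e κ) _ (stairWord σ' n) (by rw [disp_stairWord]; abel)]

omit [NormedAlgebra ℂ 𝔸] [NormOneClass 𝔸] [CompleteSpace 𝔸] in
/-- The (0.4) loop variable through the open three-piece contour: `W_i = V₀(Γ^σ ∪ [x,x′] ∪ (−Γ^{σ′}))·V₀(c)⁻¹` (the engine's `Wcx = V(Γ_{c,x})V(c)⁻¹`).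
[cite: Balaban1987RG1, (0.4) p.253; Balaban1985Averaging, (42) p.23] -/
theorem WZ_eq_hol_mul (V₀ : SiteZ d → Fin d → 𝔸ˣ) (q : SiteZ d) (κ : Fin d) (i : IdxZ d L) :
    WZ L V₀ q κ i
      = hol V₀ q (stairWord i.2.1 (offZ L i.1) ++ seg κ (L : ℤ) ++ revWord (stairWord i.2.2 (offZ L i.1)))
        * (hol V₀ q (seg κ L))⁻¹ := by
  rw [WZ_def, loopWord_eq_append, hol_append, disp_gZ, ← revWord_seg, hol_revWord' V₀ (x := q) _ _ (by rw [disp_seg])]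

end Words

/-! ## §2 (115) EXACTLY for the record loop: `A_i^{(1)}` split into its four pieces -/

section LoopSplit

omit [NormedAlgebra ℂ 𝔸] [NormOneClass 𝔸] [CompleteSpace 𝔸] in
/-- **(115), exactly, for the (0.4) loop**: for `i = (x, σ, σ′)`, `A_i^{(1)} := (R_{0,c₋}A)(Γ^σ_{c₋,x} ∪ [x,x′] ∪ (−Γ^{σ′}_{c₊,x′}) ∪ (−c))`
`= (R_{0,c₋}A)(Γ^σ_{c₋,x}) + R(V₀(Γ^σ_{c₋,x}))(R_{0,x}A)([x,x′]) − R(V₀(Γ^σ∪[x,x′]∪(−Γ^{σ′})))(R_{0,c₊}A)(Γ^{σ′}_{c₊,x′}) − R(W_i)(R_{0,c₋}A)(c)` — print's "A_x =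
(R_{0,c₋}A)(Γ_{c₋,x}∪[x, x′]) − R(e^{iY_x})(R_{0,c₋}A)(c∪Γ_{c₊,x′})" with the record's two staircases (the linearised `V(−Γ) = V(Γ)⁻¹`, `tsum_revWord`).
[cite: Balaban1985Averaging, (115) p.34; Balaban1987RG1, (0.4) p.253] -/
theorem AloopZ_eq (V₀ : SiteZ d → Fin d → 𝔸ˣ) (A : SiteZ d → Fin d → 𝔸) (q : SiteZ d) (κ : Fin d) (i : IdxZ d L) :
    AloopZ L V₀ A q κ i
      = tsum V₀ A q (stairWord i.2.1 (offZ L i.1))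
        + conjR (hol V₀ q (stairWord i.2.1 (offZ L i.1))) (tsum V₀ A (q + offZ L i.1) (seg κ L))
        - conjR (hol V₀ q (stairWord i.2.1 (offZ L i.1) ++ seg κ (L : ℤ) ++ revWord (stairWord i.2.2 (offZ L i.1))))
            (tsum V₀ A (q + (L : ℤ) • e κ) (stairWord i.2.2 (offZ L i.1)))
        - conjR (WZ L V₀ q κ i) (tsum V₀ A q (seg κ L)) := by
  set n : SiteZ d := offZ L i.1 with hn
  set σ : Equiv.Perm (Fin d) := i.2.1 with hσ
  set σ' : Equiv.Perm (Fin d) := i.2.2 with hσ'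
  -- the returning straight segment `−c` from `c₊`
  have hseg : tsum V₀ A (q + (L : ℤ) • e κ) (seg κ (-(L : ℤ)))
      = -conjR ((hol V₀ q (seg κ L))⁻¹) (tsum V₀ A q (seg κ L)) := by
    rw [← revWord_seg, ← disp_seg κ (L : ℤ), tsum_revWord]
  -- the returning staircase `−Γ^{σ′}_{c₊,x′}` from `x′`
  have htw : tsum V₀ A (q + (n + (L : ℤ) • e κ)) (revWord (stairWord σ' n))
      = -conjR ((hol V₀ (q + (L : ℤ) • e κ) (stairWord σ' n))⁻¹)
          (tsum V₀ A (q + (L : ℤ) • e κ) (stairWord σ' n)) := by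
    have h := tsum_revWord V₀ A (q + (L : ℤ) • e κ) (stairWord σ' n)
    rw [disp_stairWord] at h
    rw [show q + (n + (L : ℤ) • e κ) = q + (L : ℤ) • e κ + n by abel]
    exact h
  have h1 : AloopZ L V₀ A q κ i
      = tsum V₀ A q (stairWord σ n ++ seg κ (L : ℤ) ++ revWord (stairWord σ' n))
        + conjR (hol V₀ q (stairWord σ n ++ seg κ (L : ℤ) ++ revWord (stairWord σ' n)))
            (tsum V₀ A (q + (L : ℤ) • e κ) (seg κ (-(L : ℤ)))) := by
    rw [show AloopZ L V₀ A q κ i = tsum V₀ A q (loopWord L κ n σ σ') from rfl, loopWord_eq_append, tsum_append,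
      disp_gZ]
  have h2 : tsum V₀ A q (stairWord σ n ++ seg κ (L : ℤ) ++ revWord (stairWord σ' n))
      = tsum V₀ A q (stairWord σ n)
        + conjR (hol V₀ q (stairWord σ n)) (tsum V₀ A (q + n) (seg κ L))
        + conjR (hol V₀ q (stairWord σ n) * hol V₀ (q + n) (seg κ L))
            (tsum V₀ A (q + (n + (L : ℤ) • e κ)) (revWord (stairWord σ' n))) := by
    rw [tsum_append, tsum_append, disp_append, disp_stairWord, disp_seg, hol_append, disp_stairWord]
  have hW : WZ L V₀ q κ i
      = hol V₀ q (stairWord σ n ++ seg κ (L : ℤ) ++ revWord (stairWord σ' n)) * (hol V₀ q (seg κ L))⁻¹ :=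
    WZ_eq_hol_mul L V₀ q κ i
  rw [h1, h2, htw, hseg, conjR_neg, conjR_neg, ← conjR_mul_left, ← conjR_mul_left, ← hol_gZ_eq, hW,
    sub_eq_add_neg, sub_eq_add_neg]

end LoopSplit

/-! ## §3 (124), REGROUPED FOR THE RECORD: main term + print's three defect brackets + the record defects `D₋, D₀, D₊` -/

section Split

omit [NormOneClass 𝔸] in
/-- `R̄_{0,c} = R(e^{X₀})∘R(V₀(c))` on the algebra: `bavgZ(c) = e^{XZ}·V₀(c)` ((0.4)). [cite: Balaban1987RG1, (0.4) p.253; Balaban1985Averaging, (59) p.27] -/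
theorem conjR_bavgZ (V₀ : SiteZ d → Fin d → 𝔸ˣ) (q : SiteZ d) (κ : Fin d) (Z : 𝔸) :
    conjR (bavgZ L V₀ q κ) Z = conjR (expUnit (XZ L V₀ q κ)) (conjR (hol V₀ q (seg κ L)) Z) := by
  rw [bavgZ_apply, conjR_mul_left]

omit [NormedAlgebra ℂ 𝔸] [NormOneClass 𝔸] [CompleteSpace 𝔸] in
/-- `R(V₀(Γ^σ ∪ [x,x′] ∪ (−Γ^{σ′}))) = R(W_i)∘R(V₀(c))`. [cite: Balaban1987RG1, (0.4) p.253; Balaban1985Averaging, (114) p.34] -/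
theorem conjR_gZ (V₀ : SiteZ d → Fin d → 𝔸ˣ) (q : SiteZ d) (κ : Fin d) (i : IdxZ d L) (Z : 𝔸) :
    conjR (hol V₀ q (stairWord i.2.1 (offZ L i.1) ++ seg κ (L : ℤ) ++ revWord (stairWord i.2.2 (offZ L i.1)))) Z
      = conjR (WZ L V₀ q κ i) (conjR (hol V₀ q (seg κ L)) Z) := by
  rw [← conjR_mul_left, WZ_eq_hol_mul, inv_mul_cancel_right]

omit [NormOneClass 𝔸] [CompleteSpace 𝔸] in
/-- The frame exponent `F̂_{V₀}(y)` written as a mean over the loop family (it depends on `i` only through `x = i.1`). [cite: Balaban1985Averaging, (112) p.34] -/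
theorem FhatCovZ_eq_sum_IdxZ (hL : 1 ≤ L) (V₀ : SiteZ d → Fin d → 𝔸ˣ) (A : SiteZ d → Fin d → 𝔸) (y : SiteZ d) :
    FhatCovZ L V₀ A y = ∑ i : IdxZ d L, ((Fintype.card (IdxZ d L) : ℝ))⁻¹ • tsum V₀ A y (treeWord (offZ L i.1)) := by
  rw [FhatCovZ]
  exact (sum_IdxZ_fst L hL (fun r => tsum V₀ A y (treeWord (offZ L r)))).symm

omit [NormOneClass 𝔸] in
/-- the third frame term over the loop family: `R̄_{0,c}F̂_{V₀}(c₊) = Σ_i w·R(e^{X₀})R(V₀(c))(R_{0,c₊}A)(Γ_{c₊,x′})`. [cite: Balaban1985Averaging, (120) p.35] -/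
theorem conjR_bavgZ_FhatCovZ (hL : 1 ≤ L) (V₀ : SiteZ d → Fin d → 𝔸ˣ) (A : SiteZ d → Fin d → 𝔸) (q : SiteZ d) (κ : Fin d) :
    conjR (bavgZ L V₀ q κ) (FhatCovZ L V₀ A (q + (L : ℤ) • e κ))
      = ∑ i : IdxZ d L, ((Fintype.card (IdxZ d L) : ℝ))⁻¹ •
          conjR (expUnit (XZ L V₀ q κ))
            (conjR (hol V₀ q (seg κ L)) (tsum V₀ A (q + (L : ℤ) • e κ) (treeWord (offZ L i.1)))) := by
  rw [FhatCovZ_eq_sum_IdxZ L hL, conjR_sum]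
  refine Finset.sum_congr rfl fun i _ => ?_
  rw [conjR_smul_real, conjR_bavgZ]

/-- **(124), REGROUPED FOR THE RECORD.**  Under the small-loop guard `‖W_i(V₀) − 1‖ < 1` on the block (for `linQcovZ_eq`), with `X₀ = XZ(V₀)` (`= iY`), `W_i` (`= e^{iY_i}`), `Φ := (D exp)_{X₀}(·)e^{−X₀}`
(`PhiY`), `𝒜 := R(e^{X₀})`, `w = |IdxZ|⁻¹`:
«L(Q(V₀)A)_c» `= L·(Q₀A)_c + [Φ(DXavgZ) − Σ_i w A_i^{(1)}] + [𝒜 − Σ_i w R(W_i)]((R_{0,c₋}A)(c)) + Σ_i w [𝒜 − R(W_i)]R(V₀(c))(R_{0,c₊}A)(Γ^{σ′}_{c₊,x′})` (print's (124), the engine's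
`linQcov_split`) `+ D₋ + D₀ + D₊`, the RECORD DEFECTS `D₋ = Σ_i w(R_{0,c₋}A)(Γ^σ_{c₋,x}) − F̂_{V₀}(c₋)`, `D₀ = Σ_i w R(V₀(Γ^σ_{c₋,x}))(R_{0,x}A)([x,x′]) − L·(Q₀A)_c`,
`D₊ = Σ_i w 𝒜R(V₀(c))[(R_{0,c₊}A)(Γ_{c₊,x′}) − (R_{0,c₊}A)(Γ^{σ′}_{c₊,x′})]` (all zero when `Γ^σ = Γ`, i.e. for the engine's structure; their estimate is LOCATED-N2, road (A′)).
Obtained from the closed form (120) (`linQcovZ_eq`) by (115) (`AloopZ_eq`), `R̄_{0,c} = 𝒜∘R(V₀(c))` and `R(V₀(Γ^σ∪[x,x′]∪(−Γ^{σ′}))) = R(W_i)∘R(V₀(c))`.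
[cite: Balaban1985Averaging, (124) p.36, (120) p.35, (115) p.34; Balaban1987RG1, (0.4) p.253] -/
theorem linQcovZ_split (hL : 1 ≤ L) (V₀ : SiteZ d → Fin d → 𝔸ˣ) (A : SiteZ d → Fin d → 𝔸) (q : SiteZ d) (κ : Fin d)
    (hW : ∀ i : IdxZ d L, ‖((WZ L V₀ q κ i : 𝔸ˣ) : 𝔸) - 1‖ < 1) :
    linQcovZ L V₀ A q κ
      = (L : ℝ) • Q0covZ L V₀ A q κ
        + (PhiY (XZ L V₀ q κ) (DXavgZ L V₀ A q κ)
            - ∑ i : IdxZ d L, ((Fintype.card (IdxZ d L) : ℝ))⁻¹ • AloopZ L V₀ A q κ i)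
        + (conjR (expUnit (XZ L V₀ q κ)) (tsum V₀ A q (seg κ L))
            - ∑ i : IdxZ d L, ((Fintype.card (IdxZ d L) : ℝ))⁻¹ • conjR (WZ L V₀ q κ i) (tsum V₀ A q (seg κ L)))
        + ∑ i : IdxZ d L, ((Fintype.card (IdxZ d L) : ℝ))⁻¹ •
            (conjR (expUnit (XZ L V₀ q κ))
                (conjR (hol V₀ q (seg κ L)) (tsum V₀ A (q + (L : ℤ) • e κ) (stairWord i.2.2 (offZ L i.1))))
              - conjR (WZ L V₀ q κ i)
                (conjR (hol V₀ q (seg κ L)) (tsum V₀ A (q + (L : ℤ) • e κ) (stairWord i.2.2 (offZ L i.1)))))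
        + (∑ i : IdxZ d L, ((Fintype.card (IdxZ d L) : ℝ))⁻¹ • tsum V₀ A q (stairWord i.2.1 (offZ L i.1))
            - FhatCovZ L V₀ A q)
        + (∑ i : IdxZ d L, ((Fintype.card (IdxZ d L) : ℝ))⁻¹ •
              conjR (hol V₀ q (stairWord i.2.1 (offZ L i.1))) (tsum V₀ A (q + offZ L i.1) (seg κ L))
            - (L : ℝ) • Q0covZ L V₀ A q κ)
        + ∑ i : IdxZ d L, ((Fintype.card (IdxZ d L) : ℝ))⁻¹ •
            conjR (expUnit (XZ L V₀ q κ)) (conjR (hol V₀ q (seg κ L))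
              (tsum V₀ A (q + (L : ℤ) • e κ) (treeWord (offZ L i.1))
                - tsum V₀ A (q + (L : ℤ) • e κ) (stairWord i.2.2 (offZ L i.1)))) := by
  rw [linQcovZ_eq L V₀ A q κ hW, show QprimeCovZ L V₀ A q κ
      = PhiY (XZ L V₀ q κ) (DXavgZ L V₀ A q κ) + conjR (expUnit (XZ L V₀ q κ)) (tsum V₀ A q (seg κ L)) from rfl,
    conjR_bavgZ_FhatCovZ L hL]
  simp only [AloopZ_eq, conjR_gZ, conjR_sub, smul_add, smul_sub, Finset.sum_add_distrib, Finset.sum_sub_distrib]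
  abel

end Split

/-! ## §4 The record defects ARE a covariant coarse gauge term: `D₋ + D₊ = λ_A(c₋) − R̄_{0,c}λ_A(c₊)` -/

section Gauge

omit [NormOneClass 𝔸] in
/-- **THE TWO CURL DEFECTS OF (124)-FOR-THE-RECORD FORM A LINEARISED COVARIANT GAUGE TRANSFORMATION ON THE COARSE LATTICE.**  With the site functional
`λ_A(y) := Σ_i w·(R_{0,y}A)(Γ^σ_{y,x}) − F̂_{V₀}(y)` (σ-mean staircase frame minus the single-staircase frame (112); at `V₀ = 1` it is `B7Prop3FlatRecSide.PhiZ`), the defects satisfy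
`D₋ + D₊ = λ_A(c₋) − R̄_{0,c} λ_A(c₊)` — the covariant coarse derivative `(d_{V̄₀}λ)(c)` of `λ_A`, i.e. the first-order change of `V̿₁(c)` under the coarse gauge transformation `e^{λ_A}` (cf. (59)∕(93):
`\overline{V^u} = V̄^{u}`).  Uses the symmetry `σ ↔ σ′` of the weights (0.4) (`sum_IdxZ_perm₁`).  This is the general-background form of LOCATED-N2: the record's linearised average is the
engine-shaped one FOLLOWED BY an infinitesimal coarse gauge transformation generated by `λ_A`; only the rotation defect `D₀` is a genuine (small, `O(L²α₀)`) correction.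
[cite: Balaban1987RG1, (0.4) p.253, (0.7) p.253; Balaban1985Averaging, (59) p.27, (93) p.31, (124) p.36] -/
theorem defects_eq_covGauge (hL : 1 ≤ L) (V₀ : SiteZ d → Fin d → 𝔸ˣ) (A : SiteZ d → Fin d → 𝔸) (q : SiteZ d) (κ : Fin d) :
    (∑ i : IdxZ d L, ((Fintype.card (IdxZ d L) : ℝ))⁻¹ • tsum V₀ A q (stairWord i.2.1 (offZ L i.1)) - FhatCovZ L V₀ A q)
      + ∑ i : IdxZ d L, ((Fintype.card (IdxZ d L) : ℝ))⁻¹ •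
          conjR (expUnit (XZ L V₀ q κ)) (conjR (hol V₀ q (seg κ L))
            (tsum V₀ A (q + (L : ℤ) • e κ) (treeWord (offZ L i.1))
              - tsum V₀ A (q + (L : ℤ) • e κ) (stairWord i.2.2 (offZ L i.1))))
      = (∑ i : IdxZ d L, ((Fintype.card (IdxZ d L) : ℝ))⁻¹ • tsum V₀ A q (stairWord i.2.1 (offZ L i.1)) - FhatCovZ L V₀ A q)
        - conjR (bavgZ L V₀ q κ)
            (∑ i : IdxZ d L, ((Fintype.card (IdxZ d L) : ℝ))⁻¹ •
                tsum V₀ A (q + (L : ℤ) • e κ) (stairWord i.2.1 (offZ L i.1))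
              - FhatCovZ L V₀ A (q + (L : ℤ) • e κ)) := by
  have hswap := sum_IdxZ_perm₁ L (fun r σ => conjR (expUnit (XZ L V₀ q κ)) (conjR (hol V₀ q (seg κ L))
      (tsum V₀ A (q + (L : ℤ) • e κ) (stairWord σ (offZ L r)))))
  rw [FhatCovZ_eq_sum_IdxZ L hL V₀ A (q + (L : ℤ) • e κ)]
  simp only [conjR_bavgZ, conjR_sub, conjR_sum, conjR_smul_real, smul_sub, Finset.sum_sub_distrib]
  rw [hswap]
  abel

/-- **(124) FOR THE RECORD, GAUGE FORM**: «L(Q(V₀)A)_c» `= L·(Q₀A)_c + [Φ-bracket] + [𝒜-bracket] + [third bracket] + D₀ + (λ_A(c₋) − R̄_{0,c}λ_A(c₊))` — print's (124) (the engine's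
`linQcov_split`, to which the three brackets and `L·(Q₀A)_c` reduce term by term when `Γ^σ = Γ`) plus the small rotation defect `D₀` plus a COVARIANT COARSE GAUGE TERM.  Consequence recorded
for the road (A′): the sup-norm estimate (126) «|(Q(V₀)A)_c| ≤ (1 + O(1)L²α₀)|A|» is to be read for `L(Q(V₀)A)_c − (d_{V̄₀}λ_A)(c)`; the gauge term is carried, not estimated in `|A|`.
[cite: Balaban1985Averaging, (124) p.36, (126) p.36; Balaban1987RG1, (0.4) p.253] -/
theorem linQcovZ_split_gauge (hL : 1 ≤ L) (V₀ : SiteZ d → Fin d → 𝔸ˣ) (A : SiteZ d → Fin d → 𝔸) (q : SiteZ d) (κ : Fin d)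
    (hW : ∀ i : IdxZ d L, ‖((WZ L V₀ q κ i : 𝔸ˣ) : 𝔸) - 1‖ < 1) :
    linQcovZ L V₀ A q κ
      = (L : ℝ) • Q0covZ L V₀ A q κ
        + (PhiY (XZ L V₀ q κ) (DXavgZ L V₀ A q κ)
            - ∑ i : IdxZ d L, ((Fintype.card (IdxZ d L) : ℝ))⁻¹ • AloopZ L V₀ A q κ i)
        + (conjR (expUnit (XZ L V₀ q κ)) (tsum V₀ A q (seg κ L))
            - ∑ i : IdxZ d L, ((Fintype.card (IdxZ d L) : ℝ))⁻¹ • conjR (WZ L V₀ q κ i) (tsum V₀ A q (seg κ L)))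
        + ∑ i : IdxZ d L, ((Fintype.card (IdxZ d L) : ℝ))⁻¹ •
            (conjR (expUnit (XZ L V₀ q κ))
                (conjR (hol V₀ q (seg κ L)) (tsum V₀ A (q + (L : ℤ) • e κ) (stairWord i.2.2 (offZ L i.1))))
              - conjR (WZ L V₀ q κ i)
                (conjR (hol V₀ q (seg κ L)) (tsum V₀ A (q + (L : ℤ) • e κ) (stairWord i.2.2 (offZ L i.1)))))
        + (∑ i : IdxZ d L, ((Fintype.card (IdxZ d L) : ℝ))⁻¹ •
              conjR (hol V₀ q (stairWord i.2.1 (offZ L i.1))) (tsum V₀ A (q + offZ L i.1) (seg κ L))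
            - (L : ℝ) • Q0covZ L V₀ A q κ)
        + ((∑ i : IdxZ d L, ((Fintype.card (IdxZ d L) : ℝ))⁻¹ • tsum V₀ A q (stairWord i.2.1 (offZ L i.1))
              - FhatCovZ L V₀ A q)
            - conjR (bavgZ L V₀ q κ)
                (∑ i : IdxZ d L, ((Fintype.card (IdxZ d L) : ℝ))⁻¹ •
                    tsum V₀ A (q + (L : ℤ) • e κ) (stairWord i.2.1 (offZ L i.1))
                  - FhatCovZ L V₀ A (q + (L : ℤ) • e κ))) := by
  rw [linQcovZ_split L hL V₀ A q κ hW, ← defects_eq_covGauge L hL]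
  abel

end Gauge

end Literature.MathematicalPhysics.QuantumFieldTheory.Balaban1983to89.B7Prop3GeneralLinearSplitRec
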